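import Summits.AtomisticToContinuum.HydrodynamicLimit.Theorems.TwoClocksEquilibriumFastWindowLDBirthT12LossAsymptotics
import Summits.AtomisticToContinuum.HydrodynamicLimit.Theorems.EnskogAdjointDualityAdjointEnskogTestFamilyRPairGaussianMoments
import Summits.AtomisticToContinuum.HydrodynamicLimit.Theorems.EnskogAdjointDualityAdjointEnskogTestFamilyRHalfGaussianPrep
import HarnessLib

/-!
# EnskogAdjointDuality / AdjointEnskogTestFamilyR — refutation line, stub `halfGaussian`

Registered stub `stub_halfGaussian` of the line `refutation` of the crux K2R
`Summit.AtomisticToContinuum.HydrodynamicLimit.Theses.EnskogAdjointDuality.AdjointEnskogTestFamilyR`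
(stmt-AtomisticToContinuum-11592): the one-dimensional Gaussian functions met after moving the hard-sphere
test operator onto explicit velocity weights.  With `φ₁(b) = e^{-b²/2}/√(2π)` the standard normal density,
`h(a) = ∫ (a−b)₊ φ₁`, `P₂(a) = ∫ (a−b)₊² φ₁`, `P₃(a) = ∫ (a−b)₊ (a²−b²) φ₁`:

* continuity of `h, P₂, P₃` (`k2r_ref_continuous_hP`, dominated convergence);
* `0 ≤ h(a) − a₊ ≤ e^{-a²/2}`, `h(a) − h(−a) = a`, `0 ≤ P₂(a) ≤ 1 + a²`, `|P₃(a) − a₊³| ≤ 3(1+|a|)`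
  (the `…HalfGaussianPrep` file, pointwise bounds + Gaussian moments);
* the marginal identities (`k2r_ref_marginals`): under `M(w) dw = stdGaussian` the coordinate `⟪w, ω⟫`
  along a unit vector is `γ₁` (`k2r_ref_map_inner_stdGaussian`, Mathlib's `IsGaussian.map_eq_gaussianReal`),
  so `∫ F(⟪v − w, ω⟫, ⟪w, ω⟫) M(w) dw = ∫ F(a − b, b) φ₁(b) db`, `a = ⟪v, ω⟫`; and integrability of the flux
  weight `((v−w)·ω)₊ (1 + |w|²) M(w)` (`k2r_ref_integrable_flux_weight`);
* the collision frequency `ν = collisionFrequency` of the linearised hard-sphere operator of `ℝ³`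
  (`k2r_ref_collisionFrequency_bounds`): `π|v| ≤ ν(v)` (tree: `pi_mul_norm_le_collisionFrequency`),
  `ν(v) = π E|v − w| ≤ π √(E|v − w|²) = π √(|v|² + 3)` (variance ≥ 0), and
  `|ν(v) − π|v|| ≤ 3π/(2|v|)` from the tree's `t12_collisionFrequency_le_pi` (`|v| ν(v) ≤ π(|v|² + 3/2)`).

References: C. Cercignani, R. Illner, M. Pulvirenti, *The Mathematical Theory of Dilute Gases* (1994),
§7.2 (2.13)–(2.15) [CIP1994]; H. Grad, *Asymptotic theory of the Boltzmann equation II* (1963), §4.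
-/

noncomputable section

open MeasureTheory ProbabilityTheory Set Filter Topology
open scoped InnerProductSpace Real ENNReal NNReal

namespace Summit.AtomisticToContinuum.HydrodynamicLimit.Theorems.EnskogAdjointDuality

open Literature.MathematicalPhysics.KineticTheory Literature.Analysis.FluidPDE Literature.Analysis.FunctionSpaces
open Literature.Analysis.UnboundedOperators (collisionFrequency)
open Literature.Probability.Distributions

/-! ## Continuity of the half-Gaussian moments -/

/-- Continuity of polynomially bounded parametric `γ₁`-integrals with continuous integrand. [folklore] -/
theorem k2r_ref_continuous_integral {F : ℝ → ℝ → ℝ} (hF : Continuous (Function.uncurry F)) {C : ℝ}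
    {n : ℕ} (h : ∀ a b, |F a b| ≤ C * (1 + |a|) ^ n * (1 + |b|) ^ n) :
    Continuous fun a => ∫ b, F a b ∂gaussianReal 0 1 := by
  refine continuous_iff_continuousAt.2 fun a₀ => ?_
  have hmeas : ∀ a, AEStronglyMeasurable (F a) (gaussianReal 0 1) := fun a =>
    (hF.uncurry_left a).aestronglyMeasurable
  refine continuousAt_of_dominated (bound := fun b => |C| * (2 + |a₀|) ^ n * (1 + |b|) ^ n)
    (Eventually.of_forall hmeas) ?_ ?_ ?_
  · have hball : ∀ᶠ a in 𝓝 a₀, |a - a₀| < 1 := by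
      have := Metric.ball_mem_nhds a₀ (zero_lt_one)
      filter_upwards [this] with a ha
      rwa [Metric.mem_ball, Real.dist_eq] at ha
    filter_upwards [hball] with a ha
    refine ae_of_all _ fun b => ?_
    rw [Real.norm_eq_abs]
    have h1 : |a| ≤ 1 + |a₀| := by
      have := abs_sub_abs_le_abs_sub a a₀
      linarith
    have h2 : (1 + |a|) ^ n ≤ (2 + |a₀|) ^ n :=
      pow_le_pow_left₀ (by positivity) (by linarith) n
    calc |F a b| ≤ C * (1 + |a|) ^ n * (1 + |b|) ^ n := h a b
      _ ≤ |C| * (1 + |a|) ^ n * (1 + |b|) ^ n := by gcongr; exact le_abs_self C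
      _ ≤ |C| * (2 + |a₀|) ^ n * (1 + |b|) ^ n := by gcongr
  · exact (k2r_ref_integrable_one_add_abs_pow n).const_mul _
  · exact ae_of_all _ fun b => (hF.uncurry_right b).continuousAt

/-- `h`, `P₂`, `P₃` are continuous. [folklore] -/
theorem k2r_ref_continuous_hP :
    (Continuous fun a : ℝ => ∫ b, max (a - b) 0 ∂gaussianReal 0 1) ∧
    (Continuous fun a : ℝ => ∫ b, max (a - b) 0 ^ 2 ∂gaussianReal 0 1) ∧
    (Continuous fun a : ℝ => ∫ b, max (a - b) 0 * (a ^ 2 - b ^ 2) ∂gaussianReal 0 1) := by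
  have hmax : ∀ a b : ℝ, |max (a - b) 0| ≤ (1 + |a|) * (1 + |b|) := fun a b =>
    (k2r_ref_abs_posPart_le _).trans ((abs_sub a b).trans (by nlinarith [abs_nonneg a, abs_nonneg b]))
  refine ⟨?_, ?_, ?_⟩
  · refine k2r_ref_continuous_integral (F := fun a b => max (a - b) 0) (C := 1) (n := 1) (by fun_prop)
      fun a b => ?_
    simpa using hmax a b
  · refine k2r_ref_continuous_integral (F := fun a b => max (a - b) 0 ^ 2) (C := 1) (n := 2) (by fun_prop)
      fun a b => ?_
    rw [abs_pow, one_mul, ← mul_pow]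
    exact pow_le_pow_left₀ (abs_nonneg _) (hmax a b) 2
  · refine k2r_ref_continuous_integral (F := fun a b => max (a - b) 0 * (a ^ 2 - b ^ 2)) (C := 1) (n := 3)
      (by fun_prop) fun a b => ?_
    rw [abs_mul, one_mul]
    have h2 : |a ^ 2 - b ^ 2| ≤ ((1 + |a|) * (1 + |b|)) ^ 2 := by
      refine (abs_sub _ _).trans ?_
      rw [abs_pow, abs_pow]
      nlinarith [abs_nonneg a, abs_nonneg b, mul_nonneg (abs_nonneg a) (abs_nonneg b),
        sq_nonneg (|a| * |b|), sq_nonneg (|a| + |b|)]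
    calc |max (a - b) 0| * |a ^ 2 - b ^ 2| ≤ (1 + |a|) * (1 + |b|) * ((1 + |a|) * (1 + |b|)) ^ 2 :=
          mul_le_mul (hmax a b) h2 (abs_nonneg _) (by positivity)
      _ = (1 + |a|) ^ 3 * (1 + |b|) ^ 3 := by ring

/-! ## One-dimensional marginals of the Maxwellian along a unit vector -/

/-- **The projection `w ↦ ⟪w, ω⟫` of the standard Gaussian of `ℝ³` on a unit vector is `γ₁`.** [folklore] -/
theorem k2r_ref_map_inner_stdGaussian {ω : EuclideanSpace ℝ (Fin 3)} (hω : ‖ω‖ = 1) :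
    (stdGaussian (EuclideanSpace ℝ (Fin 3))).map (fun w => ⟪w, ω⟫_ℝ) = gaussianReal 0 1 := by
  have hfun : (fun w : EuclideanSpace ℝ (Fin 3) => ⟪w, ω⟫_ℝ) = ⇑(innerSL ℝ ω) := by
    funext w
    rw [coe_innerSL_apply, real_inner_comm]
  rw [hfun, IsGaussian.map_eq_gaussianReal, integral_strongDual_stdGaussian, variance_dual_stdGaussian,
    innerSL_apply_norm, hω]
  simp

/-- `∫ F(⟪w, ω⟫) dγ(w) = ∫ F dγ₁` for measurable `F` and a unit vector `ω`. [folklore] -/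
theorem k2r_ref_integral_comp_inner {ω : EuclideanSpace ℝ (Fin 3)} (hω : ‖ω‖ = 1) {F : ℝ → ℝ}
    (hF : Measurable F) :
    ∫ w, F ⟪w, ω⟫_ℝ ∂stdGaussian (EuclideanSpace ℝ (Fin 3)) = ∫ b, F b ∂gaussianReal 0 1 := by
  rw [← k2r_ref_map_inner_stdGaussian hω, integral_map (by fun_prop) hF.aestronglyMeasurable]

/-- **Marginal of the Maxwellian along a unit vector**:
`∫ F(⟪w, ω⟫) M(w) dw = ∫ F(b) φ₁(b) db` for measurable `F`. [folklore] -/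
theorem k2r_ref_integral_comp_inner_mul_globalMaxwellian {ω : EuclideanSpace ℝ (Fin 3)} (hω : ‖ω‖ = 1)
    {F : ℝ → ℝ} (hF : Measurable F) :
    ∫ w, F ⟪w, ω⟫_ℝ * globalMaxwellian w =
      ∫ b, F b * (Real.exp (-b ^ 2 / 2) / Real.sqrt (2 * Real.pi)) := by
  rw [k2r_ref_integral_mul_phi, ← k2r_ref_integral_comp_inner hω hF,
    integral_stdGaussian_eq_integral_mul_globalMaxwellian]
  exact integral_congr_ae (ae_of_all _ fun w => mul_comm _ _)

/-- The flux weight `((v − w)·ω)₊ (1 + |w|²) M(w)` is Lebesgue integrable. [folklore] -/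
theorem k2r_ref_integrable_flux_weight (ω : Metric.sphere (0 : EuclideanSpace ℝ (Fin 3)) 1)
    (v : EuclideanSpace ℝ (Fin 3)) :
    Integrable fun w : EuclideanSpace ℝ (Fin 3) =>
      max ⟪v - w, (ω : EuclideanSpace ℝ (Fin 3))⟫_ℝ 0 * (1 + ‖w‖ ^ 2) * globalMaxwellian w := by
  have hω : ‖(ω : EuclideanSpace ℝ (Fin 3))‖ = 1 := norm_eq_of_mem_sphere ω
  have hdom : Integrable fun w : EuclideanSpace ℝ (Fin 3) =>
      (1 + ‖v‖) * ((1 + ‖w‖) ^ 3 * localMaxwellian 1 1 (0 : EuclideanSpace ℝ (Fin 3)) w) :=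
    (integrable_one_add_norm_pow_mul_localMaxwellian one_pos (0 : EuclideanSpace ℝ (Fin 3)) 3).const_mul _
  refine hdom.mono' ?_ (ae_of_all _ fun w => ?_)
  · have hc : Continuous fun w : EuclideanSpace ℝ (Fin 3) =>
        max ⟪v - w, (ω : EuclideanSpace ℝ (Fin 3))⟫_ℝ 0 * (1 + ‖w‖ ^ 2) * globalMaxwellian w := by
      have hM := continuous_globalMaxwellian (E := EuclideanSpace ℝ (Fin 3))
      fun_prop
    exact hc.aestronglyMeasurable
  · rw [localMaxwellian_one_one_zero]
    have hM : 0 ≤ globalMaxwellian w := (globalMaxwellian_pos w).le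
    have h1 : max ⟪v - w, (ω : EuclideanSpace ℝ (Fin 3))⟫_ℝ 0 ≤ (1 + ‖v‖) * (1 + ‖w‖) :=
      max_le ((le_abs_self _).trans (k2r_abs_inner_sub_le v w _ hω)) (by positivity)
    have h2 : 1 + ‖w‖ ^ 2 ≤ (1 + ‖w‖) ^ 2 := by nlinarith [norm_nonneg w]
    rw [Real.norm_eq_abs, abs_mul, abs_mul, abs_of_nonneg (le_max_right _ _),
      abs_of_nonneg (by positivity : (0 : ℝ) ≤ 1 + ‖w‖ ^ 2), abs_of_nonneg hM]
    calc max ⟪v - w, (ω : EuclideanSpace ℝ (Fin 3))⟫_ℝ 0 * (1 + ‖w‖ ^ 2) * globalMaxwellian w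
        ≤ (1 + ‖v‖) * (1 + ‖w‖) * (1 + ‖w‖) ^ 2 * globalMaxwellian w := by gcongr
      _ = (1 + ‖v‖) * ((1 + ‖w‖) ^ 3 * globalMaxwellian w) := by ring

/-- **The three marginal identities** for `((v − w)·ω)₊`, `((v − w)·ω)₊ ((v − w)·ω)` and
`((v − w)·ω)₊ ((v·ω)² − (w·ω)²)` against the Maxwellian. [folklore] -/
theorem k2r_ref_marginals (ω : Metric.sphere (0 : EuclideanSpace ℝ (Fin 3)) 1) (v : EuclideanSpace ℝ (Fin 3)) :
    (∫ w : EuclideanSpace ℝ (Fin 3), max ⟪v - w, (ω : EuclideanSpace ℝ (Fin 3))⟫_ℝ 0 * globalMaxwellian w)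
      = ∫ b, max (⟪v, (ω : EuclideanSpace ℝ (Fin 3))⟫_ℝ - b) 0 *
          (Real.exp (-b ^ 2 / 2) / Real.sqrt (2 * Real.pi)) ∧
    (∫ w : EuclideanSpace ℝ (Fin 3), max ⟪v - w, (ω : EuclideanSpace ℝ (Fin 3))⟫_ℝ 0 *
        ⟪v - w, (ω : EuclideanSpace ℝ (Fin 3))⟫_ℝ * globalMaxwellian w)
      = ∫ b, max (⟪v, (ω : EuclideanSpace ℝ (Fin 3))⟫_ℝ - b) 0 ^ 2 *
          (Real.exp (-b ^ 2 / 2) / Real.sqrt (2 * Real.pi)) ∧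
    (∫ w : EuclideanSpace ℝ (Fin 3), max ⟪v - w, (ω : EuclideanSpace ℝ (Fin 3))⟫_ℝ 0 *
        (⟪v, (ω : EuclideanSpace ℝ (Fin 3))⟫_ℝ ^ 2 - ⟪w, (ω : EuclideanSpace ℝ (Fin 3))⟫_ℝ ^ 2) *
          globalMaxwellian w)
      = ∫ b, max (⟪v, (ω : EuclideanSpace ℝ (Fin 3))⟫_ℝ - b) 0 * (⟪v, (ω : EuclideanSpace ℝ (Fin 3))⟫_ℝ ^ 2 - b ^ 2) *
          (Real.exp (-b ^ 2 / 2) / Real.sqrt (2 * Real.pi)) := by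
  have hω : ‖(ω : EuclideanSpace ℝ (Fin 3))‖ = 1 := norm_eq_of_mem_sphere ω
  set a : ℝ := ⟪v, (ω : EuclideanSpace ℝ (Fin 3))⟫_ℝ with ha
  have hsub : ∀ w : EuclideanSpace ℝ (Fin 3),
      ⟪v - w, (ω : EuclideanSpace ℝ (Fin 3))⟫_ℝ = a - ⟪w, (ω : EuclideanSpace ℝ (Fin 3))⟫_ℝ := fun w => by
    rw [inner_sub_left]
  have hm1 : Measurable fun b : ℝ => max (a - b) 0 :=
    ((continuous_const.sub continuous_id).max continuous_const).measurable
  have hm2 : Measurable fun b : ℝ => max (a - b) 0 ^ 2 :=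
    (((continuous_const.sub continuous_id).max continuous_const).pow 2).measurable
  have hm3 : Measurable fun b : ℝ => max (a - b) 0 * (a ^ 2 - b ^ 2) :=
    (((continuous_const.sub continuous_id).max continuous_const).mul
      (continuous_const.sub (continuous_id.pow 2))).measurable
  refine ⟨?_, ?_, ?_⟩
  · calc ∫ w : EuclideanSpace ℝ (Fin 3), max ⟪v - w, (ω : EuclideanSpace ℝ (Fin 3))⟫_ℝ 0 * globalMaxwellian w
        = ∫ w : EuclideanSpace ℝ (Fin 3), (fun b : ℝ => max (a - b) 0) ⟪w, (ω : EuclideanSpace ℝ (Fin 3))⟫_ℝ *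
            globalMaxwellian w := integral_congr_ae (ae_of_all _ fun w => by simp only [hsub])
      _ = _ := k2r_ref_integral_comp_inner_mul_globalMaxwellian hω hm1
  · calc ∫ w : EuclideanSpace ℝ (Fin 3), max ⟪v - w, (ω : EuclideanSpace ℝ (Fin 3))⟫_ℝ 0 *
          ⟪v - w, (ω : EuclideanSpace ℝ (Fin 3))⟫_ℝ * globalMaxwellian w
        = ∫ w : EuclideanSpace ℝ (Fin 3), (fun b : ℝ => max (a - b) 0 ^ 2) ⟪w, (ω : EuclideanSpace ℝ (Fin 3))⟫_ℝ *
            globalMaxwellian w := by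
          refine integral_congr_ae (ae_of_all _ fun w => ?_)
          simp only [hsub]
          congr 1
          rcases le_total 0 (a - ⟪w, (ω : EuclideanSpace ℝ (Fin 3))⟫_ℝ) with h | h
          · rw [max_eq_left h, sq]
          · rw [max_eq_right h, zero_mul, zero_pow two_ne_zero]
      _ = _ := k2r_ref_integral_comp_inner_mul_globalMaxwellian hω hm2
  · calc ∫ w : EuclideanSpace ℝ (Fin 3), max ⟪v - w, (ω : EuclideanSpace ℝ (Fin 3))⟫_ℝ 0 *
          (a ^ 2 - ⟪w, (ω : EuclideanSpace ℝ (Fin 3))⟫_ℝ ^ 2) * globalMaxwellian w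
        = ∫ w : EuclideanSpace ℝ (Fin 3), (fun b : ℝ => max (a - b) 0 * (a ^ 2 - b ^ 2))
            ⟪w, (ω : EuclideanSpace ℝ (Fin 3))⟫_ℝ * globalMaxwellian w :=
          integral_congr_ae (ae_of_all _ fun w => by simp only [hsub])
      _ = _ := k2r_ref_integral_comp_inner_mul_globalMaxwellian hω hm3

/-! ## The collision frequency -/

/-- **Two-sided large-speed asymptotics of the hard-sphere collision frequency of `ℝ³`:**
`π|v| ≤ ν(v) ≤ π √(|v|² + 3)` and `|ν(v) − π|v|| ≤ 3π/(2|v|)` for `v ≠ 0`. [folklore] -/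
theorem k2r_ref_collisionFrequency_bounds (v : EuclideanSpace ℝ (Fin 3)) :
    Real.pi * ‖v‖ ≤ collisionFrequency v ∧ collisionFrequency v ≤ Real.pi * Real.sqrt (‖v‖ ^ 2 + 3) ∧
    (v ≠ 0 → |collisionFrequency v - Real.pi * ‖v‖| ≤ 3 * Real.pi / (2 * ‖v‖)) := by
  have hlow := Literature.Analysis.UnboundedOperators.pi_mul_norm_le_collisionFrequency v
  refine ⟨hlow, ?_, fun hv => ?_⟩
  · rw [ClampedCorrectorBirth.collisionFrequency_eq_pi_mul_integral_norm_sub]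
    refine mul_le_mul_of_nonneg_left (Real.le_sqrt_of_sq_le ?_) Real.pi_pos.le
    have hX := ClampedCorrectorBirth.memLp_two_norm_sub v
    have hvar := variance_nonneg (fun w : EuclideanSpace ℝ (Fin 3) => ‖v - w‖) (stdGaussian (EuclideanSpace ℝ (Fin 3)))
    rw [variance_eq_sub hX] at hvar
    have h2 : ∫ w, ((fun w : EuclideanSpace ℝ (Fin 3) => ‖v - w‖) ^ 2) w ∂stdGaussian (EuclideanSpace ℝ (Fin 3)) =
        ‖v‖ ^ 2 + 3 := by
      simp only [Pi.pow_apply]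
      exact ClampedCorrectorBirth.integral_norm_sub_sq_stdGaussian v
    rw [h2] at hvar
    linarith
  · have hup := ClampedCorrectorBirth.t12_collisionFrequency_le_pi v
    have hvpos : 0 < ‖v‖ := norm_pos_iff.2 hv
    rw [abs_of_nonneg (sub_nonneg.2 hlow), le_div_iff₀ (by positivity)]
    nlinarith

/-- **Registered stub `stub_halfGaussian`** (line `refutation` of crux K2R
`Summit.AtomisticToContinuum.HydrodynamicLimit.Theses.EnskogAdjointDuality.AdjointEnskogTestFamilyR`): the
half-Gaussian moments `h`, `P₂`, `P₃`, the one-dimensional marginals of the Maxwellian flux weights along a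
unit vector, and the two-sided asymptotics of the hard-sphere collision frequency — verbatim registered
signature. [folklore] -/
theorem stub_halfGaussian :
  let φ₁ : ℝ → ℝ := fun b => Real.exp (-b ^ 2 / 2) / Real.sqrt (2 * Real.pi)
  let h : ℝ → ℝ := fun a => ∫ b, max (a - b) 0 * φ₁ b
  let P₂ : ℝ → ℝ := fun a => ∫ b, max (a - b) 0 ^ 2 * φ₁ b
  let P₃ : ℝ → ℝ := fun a => ∫ b, max (a - b) 0 * (a ^ 2 - b ^ 2) * φ₁ b
  (Continuous h ∧ Continuous P₂ ∧ Continuous P₃) ∧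
  (∀ a, 0 ≤ h a - max a 0 ∧ h a - max a 0 ≤ Real.exp (-a ^ 2 / 2) ∧ h a - h (-a) = a) ∧
  (∀ a, 0 ≤ P₂ a ∧ P₂ a ≤ 1 + a ^ 2) ∧
  (∀ a, |P₃ a - max a 0 ^ 3| ≤ 3 * (1 + |a|)) ∧
  (∀ (ω : Metric.sphere (0 : EuclideanSpace ℝ (Fin 3)) 1) (v : EuclideanSpace ℝ (Fin 3)),
    (Integrable fun w : EuclideanSpace ℝ (Fin 3) =>
        max (inner ℝ (v - w) (ω : EuclideanSpace ℝ (Fin 3))) 0 * (1 + ‖w‖ ^ 2) * globalMaxwellian w) ∧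
    (∫ w : EuclideanSpace ℝ (Fin 3), max (inner ℝ (v - w) (ω : EuclideanSpace ℝ (Fin 3))) 0 * globalMaxwellian w)
      = h (inner ℝ v (ω : EuclideanSpace ℝ (Fin 3))) ∧
    (∫ w : EuclideanSpace ℝ (Fin 3), max (inner ℝ (v - w) (ω : EuclideanSpace ℝ (Fin 3))) 0 *
        inner ℝ (v - w) (ω : EuclideanSpace ℝ (Fin 3)) * globalMaxwellian w)
      = P₂ (inner ℝ v (ω : EuclideanSpace ℝ (Fin 3))) ∧
    (∫ w : EuclideanSpace ℝ (Fin 3), max (inner ℝ (v - w) (ω : EuclideanSpace ℝ (Fin 3))) 0 *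
        (inner ℝ v (ω : EuclideanSpace ℝ (Fin 3)) ^ 2 - inner ℝ w (ω : EuclideanSpace ℝ (Fin 3)) ^ 2) *
          globalMaxwellian w)
      = P₃ (inner ℝ v (ω : EuclideanSpace ℝ (Fin 3)))) ∧
  (∀ v : EuclideanSpace ℝ (Fin 3),
    Real.pi * ‖v‖ ≤ collisionFrequency v ∧ collisionFrequency v ≤ Real.pi * Real.sqrt (‖v‖ ^ 2 + 3) ∧
    (v ≠ 0 → |collisionFrequency v - Real.pi * ‖v‖| ≤ 3 * Real.pi / (2 * ‖v‖))) := by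
  intro φ₁ h P₂ P₃
  have hh : ∀ a, h a = ∫ b, max (a - b) 0 ∂gaussianReal 0 1 := fun a =>
    k2r_ref_integral_mul_phi (fun b => max (a - b) 0)
  have hP₂ : ∀ a, P₂ a = ∫ b, max (a - b) 0 ^ 2 ∂gaussianReal 0 1 := fun a =>
    k2r_ref_integral_mul_phi (fun b => max (a - b) 0 ^ 2)
  have hP₃ : ∀ a, P₃ a = ∫ b, max (a - b) 0 * (a ^ 2 - b ^ 2) ∂gaussianReal 0 1 := fun a =>
    k2r_ref_integral_mul_phi (fun b => max (a - b) 0 * (a ^ 2 - b ^ 2))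
  obtain ⟨c1, c2, c3⟩ := k2r_ref_continuous_hP
  refine ⟨⟨c1.congr fun a => (hh a).symm, c2.congr fun a => (hP₂ a).symm, c3.congr fun a => (hP₃ a).symm⟩,
    fun a => ?_, fun a => ?_, fun a => ?_, fun ω v => ?_, k2r_ref_collisionFrequency_bounds⟩
  · have hge := k2r_ref_h_ge a
    have hsym := k2r_ref_h_sub_h_neg a
    rw [← hh a] at hge
    rw [← hh a, ← hh (-a)] at hsym
    refine ⟨sub_nonneg.2 hge, ?_, hsym⟩
    rcases le_total a 0 with ha | ha
    · rw [max_eq_right ha, sub_zero]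
      exact k2r_ref_h_le_exp ha
    · rw [max_eq_left ha]
      have e : h a - a = h (-a) := by linarith
      rw [e]
      have hle := k2r_ref_h_le_exp (neg_nonpos.2 ha)
      rw [neg_sq] at hle
      exact hle
  · rw [hP₂ a]
    exact k2r_ref_P2_bounds a
  · rw [hP₃ a]
    exact k2r_ref_P3_bound a
  · obtain ⟨m1, m2, m3⟩ := k2r_ref_marginals ω v
    exact ⟨k2r_ref_integrable_flux_weight ω v, m1, m2, m3⟩

end Summit.AtomisticToContinuum.HydrodynamicLimit.Theorems.EnskogAdjointDuality
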